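import Literature.NumberTheory.Sieve.SmoothParityTernary
import HarnessLib

/-!
# Crude bounds for the cancelling majorants `classLocalHc` and their sums over the major arcs

Topic `Literature/NumberTheory/Sieve`, namespace `Literature.NumberTheory.Sieve.SmoothArcs`; a PROVED tool file of the
circle-method engine of `SmoothParityTernary` ([Harper2016, §2.2, §5]).  The major-arc theorem `parity_major_arcs`
(`SmoothParityMajorArcs`) carries two arithmetic sums over the arcs `k ≤ R`, `(k, a) = 1` of the cancelling majorants
`Hc = classLocalHc` (`SmoothArcClassesMajorant`): `𝓗₃(R) = ΣΣ Hc₁Hc₂Hc₃`, which multiplies the decaying precision `η`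
and must be bounded uniformly in `R` (genuine arithmetic of the local factors, NOT done here), and
`𝓗⁺(R) = ΣΣ (1+Hc₁)(1+Hc₂)(1+Hc₃)`, which only multiplies flat errors carrying negative powers of the free window
parameter `Λ` and of `x`, so that a polynomial bound in `R` suffices.  This file gives the polynomial bound:

* `card_filter_gcd_eq_totient`: `#{t < L : (t, L) = g} = φ(L/g)` for `g ∣ L`;
* `classLocalHc_le_lcm_sq`: `classLocalHc α m r k h ≤ lcm(k, m)²` for `α ≥ 0`, `k, m ≥ 1`
  (`|C_g(h)| ≤ φ(L/g)`, so each of the `≤ L` divisor terms is `≤ g^{−α} τ(L/g) ≤ L`);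
* `parityHcSumPlus_le`: `Σ_{k ≤ R} Σ_{(k,a)=1} (1 + Hc(2,1,k;d₁a))(1 + Hc(2,1,k;σd₂a))(1 + Hc(1,0,k;a)) ≤ R²(1 + 4R²)³`.

## References

* A. J. Harper, Compositio Math. 152 (2016), §2.2, §5 [Harper2016].
-/

noncomputable section

open Finset Real Complex

namespace Literature.NumberTheory.Sieve

namespace SmoothArcs

/-- `#{t < L : (t, L) = g} = φ(L/g)` for `g ∣ L`, `L ≥ 1` (`filter_range_gcd_eq_image`). [folklore] -/
theorem card_filter_gcd_eq_totient {L g : ℕ} (hL : L ≠ 0) (hg : g ∣ L) :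
    ((Finset.range L).filter (fun t => Nat.gcd t L = g)).card = (L / g).totient := by
  classical
  have hg0 : 0 < g := Nat.pos_of_dvd_of_pos hg (Nat.pos_of_ne_zero hL)
  rw [filter_range_gcd_eq_image hL hg, Finset.card_image_of_injective _ (mul_right_injective₀ hg0.ne'),
    Nat.totient_eq_card_coprime]
  exact congrArg Finset.card (Finset.filter_congr fun b _ => Nat.coprime_comm)

/-- **Crude bound for the cancelling majorant**: `classLocalHc α m r k h ≤ lcm(k, m)²` for `α ≥ 0`, `k, m ≥ 1`
(`|C_g(h)| ≤ #{t : (t, L) = g} = φ(L/g)`, `g^{−α} ≤ 1`, `τ(L/g) ≤ L/g ≤ L`, and at most `L` divisors). [folklore] -/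
theorem classLocalHc_le_lcm_sq {α : ℝ} (hα : 0 ≤ α) {m k : ℕ} (hm : m ≠ 0) (hk : k ≠ 0) (r : ℕ) (h : ℤ) :
    classLocalHc α m r k h ≤ ((Nat.lcm k m : ℕ) : ℝ) ^ 2 := by
  classical
  unfold classLocalHc
  set L : ℕ := Nat.lcm k m with hL
  have hL0 : L ≠ 0 := Nat.lcm_ne_zero hk hm
  have hterm : ∀ g ∈ L.divisors, ‖classGcdSum m r k h g‖ *
      (((g : ℕ) : ℝ) ^ (-α) * ((L / g).divisors.card : ℝ) / ((L / g).totient : ℝ)) ≤ (L : ℝ) := by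
    intro g hgd
    have hgL : g ∣ L := Nat.dvd_of_mem_divisors hgd
    have hg0 : 0 < g := Nat.pos_of_mem_divisors hgd
    set n : ℕ := L / g with hn
    have hn0 : n ≠ 0 := (Nat.div_ne_zero_iff_of_dvd hgL).mpr ⟨hL0, hg0.ne'⟩
    have hφ0 : (0 : ℝ) < (n.totient : ℝ) := by exact_mod_cast Nat.totient_pos.mpr (Nat.pos_of_ne_zero hn0)
    -- `|C_g(h)| ≤ φ(n)`
    have hC : ‖classGcdSum m r k h g‖ ≤ (n.totient : ℝ) := by
      refine (norm_classGcdSum_le_card m r k h g).trans ?_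
      rw [← hL, ← card_filter_gcd_eq_totient hL0 hgL]
      exact_mod_cast Finset.card_le_card fun t ht => by
        simp only [Finset.mem_filter] at ht ⊢
        exact ⟨ht.1, ht.2.2⟩
    have hgα : ((g : ℕ) : ℝ) ^ (-α) ≤ 1 :=
      Real.rpow_le_one_of_one_le_of_nonpos (by exact_mod_cast hg0) (by linarith)
    have hτ : (n.divisors.card : ℝ) ≤ n := by exact_mod_cast Nat.card_divisors_le_self n
    have hnL : (n : ℝ) ≤ L := by exact_mod_cast Nat.div_le_self L g
    have hτ0 : (0 : ℝ) ≤ n.divisors.card := Nat.cast_nonneg _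
    calc ‖classGcdSum m r k h g‖ * (((g : ℕ) : ℝ) ^ (-α) * (n.divisors.card : ℝ) / (n.totient : ℝ))
        ≤ (n.totient : ℝ) * (((g : ℕ) : ℝ) ^ (-α) * (n.divisors.card : ℝ) / (n.totient : ℝ)) :=
          mul_le_mul_of_nonneg_right hC (by positivity)
      _ = ((g : ℕ) : ℝ) ^ (-α) * (n.divisors.card : ℝ) := by field_simp
      _ ≤ 1 * (n.divisors.card : ℝ) := mul_le_mul_of_nonneg_right hgα hτ0
      _ ≤ L := by linarith
  refine (Finset.sum_le_sum hterm).trans ?_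
  rw [Finset.sum_const, nsmul_eq_mul]
  have hcard : (L.divisors.card : ℝ) ≤ L := by exact_mod_cast Nat.card_divisors_le_self L
  have hL0' : (0 : ℝ) ≤ L := Nat.cast_nonneg L
  nlinarith

/-- **Polynomial bound for the `(1 + Hc)`-sum over the major arcs**: for `α ≥ 0` and every `R`,
`Σ_{1 ≤ k ≤ R} Σ_{a < k, (k,a)=1} (1 + Hc(2,1,k;d₁a))(1 + Hc(2,1,k;σd₂a))(1 + Hc(1,0,k;a)) ≤ R²(1 + 4R²)³`
(`classLocalHc_le_lcm_sq` with `lcm(k,2) ≤ 2k ≤ 2R`, `lcm(k,1) = k`; at most `k ≤ R` classes `a`). [folklore] -/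
theorem parityHcSumPlus_le {α : ℝ} (hα : 0 ≤ α) (σ : ℤ) (d₁ d₂ R : ℕ) :
    ∑ k ∈ Icc 1 R, ∑ a ∈ (Finset.range k).filter (Nat.Coprime k),
        (1 + classLocalHc α 2 1 k (d₁ * a)) * (1 + classLocalHc α 2 1 k (σ * (d₂ * a))) *
          (1 + classLocalHc α 1 0 k a) ≤ (R : ℝ) ^ 2 * (1 + 4 * (R : ℝ) ^ 2) ^ 3 := by
  have hR0 : (0 : ℝ) ≤ R := Nat.cast_nonneg R
  have hinner : ∀ k ∈ Icc 1 R, ∑ a ∈ (Finset.range k).filter (Nat.Coprime k),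
      (1 + classLocalHc α 2 1 k (d₁ * a)) * (1 + classLocalHc α 2 1 k (σ * (d₂ * a))) *
        (1 + classLocalHc α 1 0 k a) ≤ (R : ℝ) * (1 + 4 * (R : ℝ) ^ 2) ^ 3 := by
    intro k hk
    obtain ⟨hk1, hkR⟩ := Finset.mem_Icc.mp hk
    have hk0 : k ≠ 0 := by omega
    have hkR' : (k : ℝ) ≤ R := by exact_mod_cast hkR
    have hk0' : (0 : ℝ) ≤ k := Nat.cast_nonneg k
    have hl2 : ((Nat.lcm k 2 : ℕ) : ℝ) ≤ 2 * R := by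
      have : Nat.lcm k 2 ≤ k * 2 := Nat.le_of_dvd (by positivity) (Nat.lcm_dvd_mul k 2)
      calc ((Nat.lcm k 2 : ℕ) : ℝ) ≤ ((k * 2 : ℕ) : ℝ) := by exact_mod_cast this
        _ = 2 * k := by push_cast; ring
        _ ≤ 2 * R := by linarith
    have hb2 : ∀ h : ℤ, classLocalHc α 2 1 k h ≤ 4 * (R : ℝ) ^ 2 := fun h =>
      (classLocalHc_le_lcm_sq hα two_ne_zero hk0 1 h).trans (by nlinarith [Nat.cast_nonneg (α := ℝ) (Nat.lcm k 2)])
    have hb1 : ∀ h : ℤ, classLocalHc α 1 0 k h ≤ 4 * (R : ℝ) ^ 2 := fun h => by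
      refine (classLocalHc_le_lcm_sq hα one_ne_zero hk0 0 h).trans ?_
      rw [Nat.lcm_one_right]
      nlinarith
    have hpt : ∀ a ∈ (Finset.range k).filter (Nat.Coprime k),
        (1 + classLocalHc α 2 1 k (d₁ * a)) * (1 + classLocalHc α 2 1 k (σ * (d₂ * a))) *
          (1 + classLocalHc α 1 0 k a) ≤ (1 + 4 * (R : ℝ) ^ 2) ^ 3 := by
      intro a _
      have h0 : ∀ (mm rr : ℕ) (h : ℤ), 0 ≤ 1 + classLocalHc α mm rr k h := fun mm rr h =>
        add_nonneg zero_le_one (classLocalHc_nonneg α mm rr k h)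
      calc (1 + classLocalHc α 2 1 k (d₁ * a)) * (1 + classLocalHc α 2 1 k (σ * (d₂ * a))) * (1 + classLocalHc α 1 0 k a)
          ≤ (1 + 4 * (R : ℝ) ^ 2) * (1 + 4 * (R : ℝ) ^ 2) * (1 + 4 * (R : ℝ) ^ 2) :=
            mul_le_mul (mul_le_mul (by linarith [hb2 (d₁ * a)]) (by linarith [hb2 (σ * (d₂ * a))]) (h0 2 1 _)
              (by positivity)) (by linarith [hb1 a]) (h0 1 0 _) (by positivity)
        _ = (1 + 4 * (R : ℝ) ^ 2) ^ 3 := by ring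
    refine (Finset.sum_le_sum hpt).trans ?_
    rw [Finset.sum_const, nsmul_eq_mul]
    have hcard : (((Finset.range k).filter (Nat.Coprime k)).card : ℝ) ≤ R :=
      le_trans (by exact_mod_cast (Finset.card_filter_le _ _).trans (Finset.card_range k).le) hkR'
    exact mul_le_mul_of_nonneg_right hcard (by positivity)
  refine (Finset.sum_le_sum hinner).trans ?_
  rw [Finset.sum_const, nsmul_eq_mul, Nat.card_Icc, Nat.add_sub_cancel]
  ring_nf
  rfl

end SmoothArcs

end Literature.NumberTheory.Sieve

end
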